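import Summits.AtomisticToContinuum.Crystallization.Theorems.ChartedZeroExcessLayeredLatticeLiouvilleZZZM
import Summits.AtomisticToContinuum.Crystallization.Theorems.ChartedZeroExcessLayeredLatticeLiouvilleZZZK

/-!
(SPLIT FOR THE 400-LINE CAP by the landing lane, hand-2 g40: this file = part 1 of 2; sequels `…ChartedZeroExcessLayeredLatticeLiouvilleZZZP` import it in a chain; same namespace, all FQNs unchanged.)
# Charted zero-excess layered-lattice Liouville — ZZZP «AffineExtrapolation + LabelPairedVariationalDoor» (NODE 84, lens-2 g84)

Rider on the tree (imports only the LANDED parts ZZZM, ZZZK; 0 sorry; standard axioms).  Three sections (§1 independent of §2–§3).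

* §1 (T♭) **AFFINE EXTRAPOLATION** (CRITIC-LEDGER row 1535 (c), first item of the g84 ORDER): two affine maps `y ↦ Aᵢ y + tᵢ` that agree
  within `β` at a base point `x₀` and at points `xⱼ` agree within `β·(1 + 2·Σ|αⱼ|)` at `x₀ + Σ αⱼ (xⱼ − x₀)` (`dist_affine_combo_le`; rigid
  motions `dist_rigid_combo_le`; affine maps `dist_affineMap_combo_le`; convex weights give `3β`, `dist_affine_combo_le_three` — the «two rigid
  motions β-agreeing on a cap agree to 3β on its hull»); the planar coefficient bound `|i| + |j| ≤ 2‖i v₁ + j v₂‖` for a unit `60°` frame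
  (`abs_add_abs_le_two_mul_norm`: in-layer lattice sites within `R` of the base have `Σ|α| ≤ 2R`).  Pure normed-space lemmas, reusable by the
  band-pinning step of (AR₂♮) and by (LN₂♮).

* §2 **W2 «LABEL-PAIRED VARIATIONAL DOOR»** (the lens's re-cut of the generic side, memo `g84/memo/NODE-g84.md` §3): the mild door [MCMCᶜ]
  (`MildCoolMoatClampedCoreP`, tree YHA) is derived from FOUR pieces by the variational glue of tree YI-5 with the INDEX PAIRING REPLACED BY THE
  CANONICAL BOND LABEL: (SC) `CoolZoneShadowCrystalP` (tree YZ) ∧ (GL₂) `BondLabelP₂` (tree ZZZD; PROVED at the record dials, ZZZK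
  `bondLabelP₂_record`) ∧ (QEᴸ) `LabelSlavedFillingP` «a clamped-critical tame filling `y` exists within `dL` of the LABEL IMAGE `lab ∘ xf` of
  the core» ∧ (QCᴸ) `LabelSegmentCoercivityP` «first-order coercivity of the clamped energy along the LABEL SEGMENT: `E(y) + κ·Σᵢ dist(xf i, y i)²
  ≤ E(xf)`» — `mildCoolMoatClampedCoreP_of_labelSlavedFilling_coercivity` (PROVED), docket-shaped instance
  `mildCoolMoatCorePG_labelPaired_record`.  NO metric registration of the loose core, NO class coherence (CBL₂), NO anchor registration (AR₂♮),
  NO labelled net (LN₂♮) is consumed: the label is used only as a PAIRING (a graph isomorphism pinned on the collar), and the twist / orientation-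
  locking obstruction of memo FINDING-OM (g83) moves from the kinematic side into the energy inequality (QCᴸ), where single-site Nash-ness and
  grand clamped minimality act.  (QEᴸ)/(QCᴸ) are TYPED here; their own decomposition (load path from the crystal patch `lab ∘ xf` through
  (XRᴸ)/(X1ᴸ)/(X2ᴸ) `LabelTubeReferenceP` / `LabelTubeConvexityP` / `LabelLoadedTubeAprioriP` — tree (XR)/(X1)/(X2ᴸ) with the metric
  matching clause of `IsTubeReference` deleted (`IsFreeTubeReference`) and the reference specialised to `lab ∘ xf` — glued by tree YO-4's engine,
  `labelSlavedFillingP_of_loadPath` (PROVED, §3); Born floor along label segments for (QCᴸ)) is typed in §3 as far as the load path and priced in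
  the memo beyond; `mildCoolMoatCorePG_W2_record` assembles [MCMC](ϑc) ⟸ (SC) ∧ (XRᴸ) ∧ (X1ᴸ) ∧ (X2ᴸ) ∧ (QCᴸ) at the docket geometry.

No `sorry`, no new axioms, no instances, no notation.
-/

noncomputable section
open scoped BigOperators Classical InnerProductSpace RealInnerProductSpace
open MeasureTheory Set Metric Filter Topology
open Literature.MathematicalPhysics.StatisticalMechanics (lennardJones)

namespace Summit.AtomisticToContinuum.Crystallization.Theorems.ChartedZeroExcessLayeredLatticeLiouville

open Summit.AtomisticToContinuum.Crystallization.Theorems.ChartedPlanarOrderRigidityDoor (E3)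
open Summit.AtomisticToContinuum.Crystallization.Theorems.ChartedPlanarOrderDensityDichotomy (μS IsSep)
open Summit.AtomisticToContinuum.Crystallization.Theorems.ChartedPlanarOrderCleanScaleP (IsCleanP IsDoorSetP)
open Summit.AtomisticToContinuum.Crystallization.Theorems.ChartedPlanarOrderMesoCut (LayeredHom EnvClose)
open Summit.AtomisticToContinuum.Crystallization.Theorems.ChartedPlanarOrderDoorLayeredOsc (IsTwoShellAffineGood)

/-! ### ZZZP-1  (T♭) affine extrapolation: two affine maps close on a base point and on spanning points are close on their affine hull,
with the loss factor `1 + 2·Σ|αⱼ|` -/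

section AffineExtrapolation

variable {V W : Type*} [NormedAddCommGroup V] [NormedSpace ℝ V] [NormedAddCommGroup W] [NormedSpace ℝ W]

/-- an affine map `y ↦ A y + t` commutes with the affine combination `x₀ + Σ αⱼ (xⱼ − x₀)`. [this file, g84] -/
theorem affine_combo_eq {ι : Type*} (s : Finset ι) (A : V →ₗ[ℝ] W) (t : W) (x₀ : V) (xs : ι → V) (α : ι → ℝ) :
    A (x₀ + ∑ j ∈ s, α j • (xs j - x₀)) + t = (A x₀ + t) + ∑ j ∈ s, α j • ((A (xs j) + t) - (A x₀ + t)) := by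
  simp only [map_add, map_sum, map_smul, map_sub, add_sub_add_right_eq_sub]
  abel

/-- ★ **(T♭) AFFINE EXTRAPOLATION.**  If `y ↦ A₁ y + t₁` and `y ↦ A₂ y + t₂` agree within `β` at `x₀` and at every `xs j` (`j ∈ s`), then at
`x₀ + Σ_{j ∈ s} αⱼ (xs j − x₀)` they agree within `β·(1 + 2·Σ|αⱼ|)`.  No isometry, injectivity or independence hypothesis. [this file, g84] -/
theorem dist_affine_combo_le {ι : Type*} (s : Finset ι) (A₁ A₂ : V →ₗ[ℝ] W) (t₁ t₂ : W) (x₀ : V) (xs : ι → V) (α : ι → ℝ) {β : ℝ}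
    (h₀ : dist (A₁ x₀ + t₁) (A₂ x₀ + t₂) ≤ β) (hs : ∀ j ∈ s, dist (A₁ (xs j) + t₁) (A₂ (xs j) + t₂) ≤ β) :
    dist (A₁ (x₀ + ∑ j ∈ s, α j • (xs j - x₀)) + t₁) (A₂ (x₀ + ∑ j ∈ s, α j • (xs j - x₀)) + t₂) ≤
      β * (1 + 2 * ∑ j ∈ s, |α j|) := by
  set D : V →ₗ[ℝ] W := A₁ - A₂ with hD
  have hf : ∀ y : V, (A₁ y + t₁) - (A₂ y + t₂) = D y + (t₁ - t₂) := fun y => by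
    simp only [hD, LinearMap.sub_apply]; abel
  have h₀' : ‖D x₀ + (t₁ - t₂)‖ ≤ β := by rw [← hf, ← dist_eq_norm]; exact h₀
  have hs' : ∀ j ∈ s, ‖D (xs j) + (t₁ - t₂)‖ ≤ β := fun j hj => by rw [← hf, ← dist_eq_norm]; exact hs j hj
  rw [dist_eq_norm, hf, affine_combo_eq s D (t₁ - t₂) x₀ xs α]
  calc ‖D x₀ + (t₁ - t₂) + ∑ j ∈ s, α j • (D (xs j) + (t₁ - t₂) - (D x₀ + (t₁ - t₂)))‖
      ≤ ‖D x₀ + (t₁ - t₂)‖ + ∑ j ∈ s, ‖α j • (D (xs j) + (t₁ - t₂) - (D x₀ + (t₁ - t₂)))‖ :=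
        (norm_add_le _ _).trans (add_le_add le_rfl (norm_sum_le _ _))
    _ ≤ β + ∑ j ∈ s, |α j| * (2 * β) := by
        refine add_le_add h₀' (Finset.sum_le_sum fun j hj => ?_)
        rw [norm_smul, Real.norm_eq_abs]
        refine mul_le_mul_of_nonneg_left ?_ (abs_nonneg _)
        calc ‖D (xs j) + (t₁ - t₂) - (D x₀ + (t₁ - t₂))‖ ≤ ‖D (xs j) + (t₁ - t₂)‖ + ‖D x₀ + (t₁ - t₂)‖ := norm_sub_le _ _
          _ ≤ β + β := add_le_add (hs' j hj) h₀'
          _ = 2 * β := by ring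
    _ = β * (1 + 2 * ∑ j ∈ s, |α j|) := by rw [← Finset.sum_mul]; ring

/-- (T♭) for AFFINE MAPS `f₁ f₂ : V →ᵃ[ℝ] W`. [this file, g84] -/
theorem dist_affineMap_combo_le {ι : Type*} (s : Finset ι) (f₁ f₂ : V →ᵃ[ℝ] W) (x₀ : V) (xs : ι → V) (α : ι → ℝ) {β : ℝ}
    (h₀ : dist (f₁ x₀) (f₂ x₀) ≤ β) (hs : ∀ j ∈ s, dist (f₁ (xs j)) (f₂ (xs j)) ≤ β) :
    dist (f₁ (x₀ + ∑ j ∈ s, α j • (xs j - x₀))) (f₂ (x₀ + ∑ j ∈ s, α j • (xs j - x₀))) ≤ β * (1 + 2 * ∑ j ∈ s, |α j|) := by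
  have e : ∀ (f : V →ᵃ[ℝ] W) (y : V), f y = f.linear y + f 0 := fun f y => by
    have := congrFun (AffineMap.decomp f) y
    simpa using this
  have h₀' : dist (f₁.linear x₀ + f₁ 0) (f₂.linear x₀ + f₂ 0) ≤ β := by rw [← e, ← e]; exact h₀
  have hs' : ∀ j ∈ s, dist (f₁.linear (xs j) + f₁ 0) (f₂.linear (xs j) + f₂ 0) ≤ β := fun j hj => by
    rw [← e, ← e]; exact hs j hj
  rw [e f₁ (x₀ + _), e f₂ (x₀ + _)]
  exact dist_affine_combo_le s f₁.linear f₂.linear (f₁ 0) (f₂ 0) x₀ xs α h₀' hs'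

/-- ★ (T♭) for RIGID MOTIONS `y ↦ Uᵢ y + tᵢ` (`Uᵢ` linear isometric equivalences) — the form in which `IsTameStar` / placed crystals supply
them: «two rigid motions β-agreeing on a base point and on a cap agree to β(1 + 2Σ|α|) on the cap's affine hull». [this file, g84] -/
theorem dist_rigid_combo_le {ι : Type*} (s : Finset ι) (U₁ U₂ : V ≃ₗᵢ[ℝ] W) (t₁ t₂ : W) (x₀ : V) (xs : ι → V) (α : ι → ℝ) {β : ℝ}
    (h₀ : dist (U₁ x₀ + t₁) (U₂ x₀ + t₂) ≤ β) (hs : ∀ j ∈ s, dist (U₁ (xs j) + t₁) (U₂ (xs j) + t₂) ≤ β) :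
    dist (U₁ (x₀ + ∑ j ∈ s, α j • (xs j - x₀)) + t₁) (U₂ (x₀ + ∑ j ∈ s, α j • (xs j - x₀)) + t₂) ≤
      β * (1 + 2 * ∑ j ∈ s, |α j|) :=
  dist_affine_combo_le s (U₁.toLinearEquiv : V →ₗ[ℝ] W) (U₂.toLinearEquiv : V →ₗ[ℝ] W) t₁ t₂ x₀ xs α h₀ hs

/-- ★ (T♭) with CONVEX WEIGHTS (`0 ≤ αⱼ`, `Σ αⱼ ≤ 1`, `0 ≤ β`): agreement within `3β` on the convex hull of `{x₀} ∪ {xs j}` — the critic's «two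
rigid motions β-agreeing on centre + cap agree to 3β on the ball they span» (CRITIC-LEDGER row 1535 (c)). [this file, g84] -/
theorem dist_affine_combo_le_three {ι : Type*} (s : Finset ι) (A₁ A₂ : V →ₗ[ℝ] W) (t₁ t₂ : W) (x₀ : V) (xs : ι → V) (α : ι → ℝ)
    {β : ℝ} (hβ : 0 ≤ β) (hα : ∀ j ∈ s, 0 ≤ α j) (hα₁ : ∑ j ∈ s, α j ≤ 1)
    (h₀ : dist (A₁ x₀ + t₁) (A₂ x₀ + t₂) ≤ β) (hs : ∀ j ∈ s, dist (A₁ (xs j) + t₁) (A₂ (xs j) + t₂) ≤ β) :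
    dist (A₁ (x₀ + ∑ j ∈ s, α j • (xs j - x₀)) + t₁) (A₂ (x₀ + ∑ j ∈ s, α j • (xs j - x₀)) + t₂) ≤ 3 * β := by
  have h := dist_affine_combo_le s A₁ A₂ t₁ t₂ x₀ xs α h₀ hs
  have habs : ∑ j ∈ s, |α j| = ∑ j ∈ s, α j := Finset.sum_congr rfl fun j hj => abs_of_nonneg (hα j hj)
  rw [habs] at h
  have hσ : 0 ≤ ∑ j ∈ s, α j := Finset.sum_nonneg hα
  nlinarith

/-- the rigid convex form. [this file, g84] -/
theorem dist_rigid_combo_le_three {ι : Type*} (s : Finset ι) (U₁ U₂ : V ≃ₗᵢ[ℝ] W) (t₁ t₂ : W) (x₀ : V) (xs : ι → V) (α : ι → ℝ)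
    {β : ℝ} (hβ : 0 ≤ β) (hα : ∀ j ∈ s, 0 ≤ α j) (hα₁ : ∑ j ∈ s, α j ≤ 1)
    (h₀ : dist (U₁ x₀ + t₁) (U₂ x₀ + t₂) ≤ β) (hs : ∀ j ∈ s, dist (U₁ (xs j) + t₁) (U₂ (xs j) + t₂) ≤ β) :
    dist (U₁ (x₀ + ∑ j ∈ s, α j • (xs j - x₀)) + t₁) (U₂ (x₀ + ∑ j ∈ s, α j • (xs j - x₀)) + t₂) ≤ 3 * β :=
  dist_affine_combo_le_three s (U₁.toLinearEquiv : V →ₗ[ℝ] W) (U₂.toLinearEquiv : V →ₗ[ℝ] W) t₁ t₂ x₀ xs α hβ hα hα₁ h₀ hs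

end AffineExtrapolation

section PlanarCoefficients

variable {F : Type*} [NormedAddCommGroup F] [InnerProductSpace ℝ F]

/-- ★ **planar coefficient bound**: for a unit `60°`-frame (`‖v₁‖ = ‖v₂‖ = 1`, `⟪v₁, v₂⟫ = 1/2` — e.g. the triangular layer basis of a layered
lattice) the coefficients of `u = i•v₁ + j•v₂` satisfy `|i| + |j| ≤ 2‖u‖`; hence in-layer lattice sites within `R` of the base point enter (T♭) with
`Σ|α| ≤ 2R`. [this file, g84] -/
theorem abs_add_abs_le_two_mul_norm {v₁ v₂ : F} (h₁ : ‖v₁‖ = 1) (h₂ : ‖v₂‖ = 1) (h₁₂ : ⟪v₁, v₂⟫_ℝ = 1 / 2) (i j : ℝ) :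
    |i| + |j| ≤ 2 * ‖i • v₁ + j • v₂‖ := by
  have hsq : ‖i • v₁ + j • v₂‖ ^ 2 = i ^ 2 + i * j + j ^ 2 := by
    rw [norm_add_sq_real, norm_smul, norm_smul, real_inner_smul_left, real_inner_smul_right, h₁, h₂, h₁₂, Real.norm_eq_abs,
      Real.norm_eq_abs, mul_one, mul_one, sq_abs, sq_abs]
    ring
  have hn : 0 ≤ ‖i • v₁ + j • v₂‖ := norm_nonneg _
  have key : (|i| + |j|) ^ 2 ≤ (2 * ‖i • v₁ + j • v₂‖) ^ 2 := by
    rw [mul_pow, hsq]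
    have hi := sq_abs i
    have hj := sq_abs j
    have hij : |i| * |j| = |i * j| := (abs_mul i j).symm
    rcases le_total 0 (i * j) with hp | hp
    · rw [abs_of_nonneg hp] at hij; nlinarith [abs_nonneg i, abs_nonneg j, sq_nonneg (i + j), sq_nonneg (i - j)]
    · rw [abs_of_nonpos hp] at hij; nlinarith [abs_nonneg i, abs_nonneg j, sq_nonneg (i + j), sq_nonneg (i - j)]
  exact (sq_le_sq₀ (by positivity) (by positivity)).1 key

end PlanarCoefficients

end Summit.AtomisticToContinuum.Crystallization.Theorems.ChartedZeroExcessLayeredLatticeLiouville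

end
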